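import Summits.CriticalPhenomena.CardyFormulaZ2.Theorems.CardyIKTransportIKLinearTransportOfFarInputs
import Summits.CriticalPhenomena.CardyFormulaZ2.Theorems.CardyIKTransportIKLinearTransportStubExchangeChain
import Summits.CriticalPhenomena.CardyFormulaZ2.Theorems.CardyIKTransportIKLinearTransportStubFarRSWWhite
import Summits.CriticalPhenomena.CardyFormulaZ2.Theorems.CardyIKTransportIKLinearTransportStubOneArmDecay
import Summits.CriticalPhenomena.CardyFormulaZ2.Theorems.CardyIKTransportIKLinearTransportStubBoxResampler
import Summits.CriticalPhenomena.CardyFormulaZ2.Theorems.CardyIKTransportIKLinearTransportStubChainSteps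

/-!
# The crux `CardyIKTransport.IKLinearTransport` (stmt-CriticalPhenomena-5076) FROM ITS THREE REMAINING INPUTS, rev c4
# (line `pinned-diagram-exchange`, skeleton v20 made importable; lead seat c4)

Theorem-only support file (`--supports stmt-CriticalPhenomena-5076`, registered sub-goal `IKLinearTransport_of_coreInputs`).
The line's reduction skeleton (`Cruxes/IKLinearTransport/Lines/pinned_diagram_exchange.lean`, v20, not importable) has exactly three
`sorry`s left; this file states the same composition with those three statements as HYPOTHESES, so that the reduction is a
kernel-checked theorem of the tree which the eventual closers of the inputs simply apply (rev c3 of this device: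
`IKLinearTransport_of_farInputs`, whose transport hypothesis was the coarser `stub_WindowTransportFar`):

* input R4 — the route crux r4 `IKMixedBoxCrossing` (stmt-CriticalPhenomena-5911);
* input GLUE — FKG-free gluing: from R4, the UNCONDITIONAL far RSW family at all aspect ratios with black rings (`stub_FarRSWInputs`);
* input CORE — Manolescu's window transport (arXiv:2502.08394 §5.3.2–§5.3.6 re-run without FKG) GIVEN every input of the printed
  proof that the line has PROVED: exchange kernels, the exchange chain (endpoint form and per-step form), the Markov box resampler,
  the far-conditioned RSW families for black and for white, density-form ratio mixing and uniform polynomial one-arm decay of either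
  colour (`stub_WindowTransportCore`, the promote candidate — dossier `Cruxes/IKLinearTransport/WindowTransportCore-promote-c4.md`).

The discharges used here are landed theorems: `stub_ExchangeChain` (p132248), `stub_ChainSteps` (p135699), `stub_BoxResampler`
(p135279), `stub_FarRSWWhite` (p132129), `stub_OneArmDecay` (p132765), and everything behind `IKLinearTransport_of_farInputs` (p131xxx).
-/

noncomputable section

namespace Summit.CriticalPhenomena.CardyFormulaZ2.Theorems.IKLinearTransport.PinnedDiagramExchange

open scoped BigOperators Topology Classical MeasureTheory ProbabilityTheory ENNReal symmDiff
open Filter Set Function MeasureTheory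
open Literature.Probability.Percolation Literature.Probability.LatticeModels
open Literature.Probability.RandomPlanarGeometry

/-- The ring family of colour `false` is the third clause of the far RSW family (skeleton glue, tree copy). [folklore] -/
theorem coreInputs_ringFamily_false_of_far :
    (∀ k : ℕ, ∃ c : ℝ, 0 < c ∧ ∀ (S : Set ℤ) (n : ℕ), 1 ≤ n → ∀ (a b : ℤ) (w h : ℕ),
        n ≤ w → w ≤ k * n → n ≤ h → h ≤ k * n → ∀ E : Set Obs, MeasurableSet E →
        FarRSWBound c S n a b w h E) →
    ∀ k : ℕ, ∃ c : ℝ, 0 < c ∧ ∀ (S : Set ℤ) (n : ℕ), 1 ≤ n → ∀ (a b : ℤ) (w h : ℕ),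
        n ≤ w → w ≤ k * n → n ≤ h → h ≤ k * n → ∀ E : Set Obs, MeasurableSet E →
        E ∈ determinedOn (farFrom a b w h n) →
        c * (νmix S).real E ≤ (νmix S).real (E ∩ {x | ∀ p ∈ monoPaths x false,
          (∃ u ∈ p, a ≤ u 0 ∧ u 0 < a + w ∧ b ≤ u 1 ∧ u 1 < b + h) → ∀ v ∈ p, v ∉ farFrom a b w h n}) := by
  intro hFar k
  obtain ⟨c, hc, h⟩ := hFar k
  exact ⟨c, hc, fun S n hn a b w hh h1 h2 h3 h4 E hE hdet => (h S n hn a b w hh h1 h2 h3 h4 E hE hdet).2.2⟩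

/-- The ring family of colour `true` is the third clause of the white far RSW family (skeleton glue, tree copy). [folklore] -/
theorem coreInputs_ringFamily_true_of_white
    (hW : ∀ k : ℕ, ∃ c : ℝ, 0 < c ∧ ∀ (S : Set ℤ) (n : ℕ), 1 ≤ n → ∀ (a b : ℤ) (w h : ℕ),
      n ≤ w → w ≤ k * n → n ≤ h → h ≤ k * n → ∀ E : Set Obs, MeasurableSet E →
      E ∈ determinedOn (farFrom a b w h n) →
      c * (νmix S).real E ≤ (νmix S).real (E ∩ {x | (x.1ᶜ, x.2) ∈ lrCross a b w h}) ∧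
      c * (νmix S).real E ≤ (νmix S).real (E ∩ {x | (x.1ᶜ, x.2) ∈ tbCross a b w h}) ∧
      c * (νmix S).real E ≤ (νmix S).real (E ∩ {x | ∀ p ∈ monoPaths x true,
        (∃ u ∈ p, a ≤ u 0 ∧ u 0 < a + w ∧ b ≤ u 1 ∧ u 1 < b + h) → ∀ v ∈ p, v ∉ farFrom a b w h n})) :
    ∀ k : ℕ, ∃ c : ℝ, 0 < c ∧ ∀ (S : Set ℤ) (n : ℕ), 1 ≤ n → ∀ (a b : ℤ) (w h : ℕ),
        n ≤ w → w ≤ k * n → n ≤ h → h ≤ k * n → ∀ E : Set Obs, MeasurableSet E →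
        E ∈ determinedOn (farFrom a b w h n) →
        c * (νmix S).real E ≤ (νmix S).real (E ∩ {x | ∀ p ∈ monoPaths x true,
          (∃ u ∈ p, a ≤ u 0 ∧ u 0 < a + w ∧ b ≤ u 1 ∧ u 1 < b + h) → ∀ v ∈ p, v ∉ farFrom a b w h n}) := by
  intro k
  obtain ⟨c, hc, h⟩ := hW k
  exact ⟨c, hc, fun S n hn a b w hh h1 h2 h3 h4 E hE hdet => (h S n hn a b w hh h1 h2 h3 h4 E hE hdet).2.2⟩

/-- **THE CRUX FROM ITS THREE REMAINING INPUTS, rev c4** (registered sub-goal `IKLinearTransport_of_coreInputs`; the line's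
skeleton v20 with its three open stubs turned into hypotheses): the route crux r4 `IKMixedBoxCrossing` (stmt-5911), the FKG-free
gluing of its 2:1 crossings into the unconditional far RSW family, and Manolescu's window transport GIVEN kernels + chain (endpoint and
per-step) + Markov box resampler + far RSW (black, white) + ratio mixing + one-arm decay, together imply `IKLinearTransport`.
Sorry-free; every other input is a landed theorem of the line, applied by name. [folklore] -/
theorem IKLinearTransport_of_coreInputs :
    Summit.CriticalPhenomena.CardyFormulaZ2.Theses.CardyIKTransport.IKMixedBoxCrossing →
    (Summit.CriticalPhenomena.CardyFormulaZ2.Theses.CardyIKTransport.IKMixedBoxCrossing →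
      ∀ k : ℕ, ∃ c : ℝ, 0 < c ∧ ∀ (S : Set ℤ) (n : ℕ), 1 ≤ n → ∀ (a b : ℤ) (w h : ℕ),
        n ≤ w → w ≤ k * n → n ≤ h → h ≤ k * n → FarRSWBound c S n a b w h Set.univ) →
    ((∃ C c : ℝ, 0 < c ∧ ∀ (S : Set ℤ) (i : ℤ), (i ∈ S ↔ i + 1 ∉ S) →
        ∃ T : Obs → Rnd → Obs, IsExchangeKernel C c S i T) →
    (∀ (n : ℕ) (S : ℕ → Set ℤ) (i : ℕ → ℤ),
      (∀ t : ℕ, t < n → (i t ∈ S t ↔ i t + 1 ∉ S t) ∧ S (t + 1) = S t ∆ {i t, i t + 1}) →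
      ∃ Tc : Obs → Rnd → Obs, Measurable (Function.uncurry Tc) ∧
        ((νmix (S 0)).prod β).map (Function.uncurry Tc) = νmix (S n) ∧
        (∀ᵐ xu ∂((νmix (S 0)).prod β),
          (∀ v : Site 2, (∀ t : ℕ, t < n → v 0 ≠ i t + 1) → (v ∈ (Tc xu.1 xu.2).1 ↔ v ∈ xu.1.1)) ∧
          (∀ f : Site 2, (∀ t : ℕ, t < n → f 0 ≠ i t ∧ f 0 ≠ i t + 1) →
            (f ∈ (Tc xu.1 xu.2).2 ↔ f ∈ xu.1.2)) ∧
          (∀ a b : Site 2, (∀ t : ℕ, t < n → a 0 ≠ i t + 1) → (∀ t : ℕ, t < n → b 0 ≠ i t + 1) →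
            (b ∈ monoCluster (Tc xu.1 xu.2) a ↔ b ∈ monoCluster xu.1 a))) ∧
        (∀ (m : ℤ) (x : Obs) (u : Rnd), Tc (vshift m x) (ushift m u) = vshift m (Tc x u))) →
    (∃ C c : ℝ, 0 < c ∧ ∀ (n : ℕ) (S : ℕ → Set ℤ) (i : ℕ → ℤ),
      (∀ t : ℕ, t < n → (i t ∈ S t ↔ i t + 1 ∉ S t) ∧ S (t + 1) = S t ∆ {i t, i t + 1}) →
      ∃ (T : ℕ → Obs → Rnd → Obs) (U : ℕ → Rnd → Rnd) (X : ℕ → Obs → Rnd → Obs),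
        (∀ t : ℕ, t < n → IsExchangeKernel C c (S t) (i t) (T t)) ∧
        (∀ t : ℕ, Measurable (U t)) ∧
        (∀ (t : ℕ) (u u' : Rnd) (v : Site 2), (∀ k : ℕ, ((v, k) ∈ u ↔ (v, k) ∈ u')) →
          ∀ k : ℕ, ((v, k) ∈ U t u ↔ (v, k) ∈ U t u')) ∧
        (∀ (t : ℕ) (m : ℤ) (u : Rnd), U t (ushift m u) = ushift m (U t u)) ∧
        (∀ (x : Obs) (u : Rnd), X 0 x u = x) ∧
        (∀ (t : ℕ) (x : Obs) (u : Rnd), X (t + 1) x u = T t (X t x u) (U t u)) ∧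
        (∀ t : ℕ, t ≤ n → Measurable (Function.uncurry (X t))) ∧
        (∀ t : ℕ, t < n →
          ((νmix (S 0)).prod β).map (fun xu : Obs × Rnd => (X t xu.1 xu.2, U t xu.2)) = (νmix (S t)).prod β) ∧
        ((νmix (S 0)).prod β).map (Function.uncurry (X n)) = νmix (S n)) →
    (∃ Kc : ℝ, 0 < Kc ∧ ∀ (S : Set ℤ) (a b : ℤ) (w h : ℕ), ∃ G : Obs → Rnd → Obs,
      Measurable (Function.uncurry G) ∧
      ((νmix S).prod β).map (Function.uncurry G) = νmix S ∧
      (∀ (x : Obs) (u : Rnd) (v : Site 2), ¬ (a ≤ v 0 ∧ v 0 < a + w ∧ b ≤ v 1 ∧ v 1 < b + h) →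
        (v ∈ (G x u).1 ↔ v ∈ x.1)) ∧
      (∀ (x : Obs) (u : Rnd) (f : Site 2), ¬ (a ≤ f 0 ∧ f 0 + 1 < a + w ∧ b ≤ f 1 ∧ f 1 + 1 < b + h) →
        (f ∈ (G x u).2 ↔ f ∈ x.2)) ∧
      (∀ (x x' : Obs) (u : Rnd),
        (∀ v : Site 2, a - 1 ≤ v 0 → v 0 ≤ a + w → b - 1 ≤ v 1 → v 1 ≤ b + h →
          ¬ (a ≤ v 0 ∧ v 0 < a + w ∧ b ≤ v 1 ∧ v 1 < b + h) → (v ∈ x.1 ↔ v ∈ x'.1)) →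
        (∀ v : Site 2, a ≤ v 0 ∧ v 0 < a + w ∧ b ≤ v 1 ∧ v 1 < b + h →
          (v ∈ (G x u).1 ↔ v ∈ (G x' u).1)) ∧
        (∀ f : Site 2, a ≤ f 0 ∧ f 0 + 1 < a + w ∧ b ≤ f 1 ∧ f 1 + 1 < b + h →
          (f ∈ (G x u).2 ↔ f ∈ (G x' u).2))) ∧
      (∀ (x x' : Obs) (E : Set Obs), MeasurableSet E →
        (∀ y y' : Obs, (∀ v : Site 2, a ≤ v 0 ∧ v 0 < a + w ∧ b ≤ v 1 ∧ v 1 < b + h → (v ∈ y.1 ↔ v ∈ y'.1)) →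
          (∀ f : Site 2, a ≤ f 0 ∧ f 0 + 1 < a + w ∧ b ≤ f 1 ∧ f 1 + 1 < b + h → (f ∈ y.2 ↔ f ∈ y'.2)) →
          (y ∈ E ↔ y' ∈ E)) →
        β {u | G x u ∈ E} ≤ ENNReal.ofReal (Kc ^ (w + h + 1)) * β {u | G x' u ∈ E})) →
    (∀ k : ℕ, ∃ c : ℝ, 0 < c ∧ ∀ (S : Set ℤ) (n : ℕ), 1 ≤ n → ∀ (a b : ℤ) (w h : ℕ),
        n ≤ w → w ≤ k * n → n ≤ h → h ≤ k * n → ∀ E : Set Obs, MeasurableSet E →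
        FarRSWBound c S n a b w h E) →
    (∀ k : ℕ, ∃ c : ℝ, 0 < c ∧ ∀ (S : Set ℤ) (n : ℕ), 1 ≤ n → ∀ (a b : ℤ) (w h : ℕ),
      n ≤ w → w ≤ k * n → n ≤ h → h ≤ k * n → ∀ E : Set Obs, MeasurableSet E →
      E ∈ determinedOn (farFrom a b w h n) →
      c * (νmix S).real E ≤ (νmix S).real (E ∩ {x | (x.1ᶜ, x.2) ∈ lrCross a b w h}) ∧
      c * (νmix S).real E ≤ (νmix S).real (E ∩ {x | (x.1ᶜ, x.2) ∈ tbCross a b w h}) ∧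
      c * (νmix S).real E ≤ (νmix S).real (E ∩ {x | ∀ p ∈ monoPaths x true,
        (∃ u ∈ p, a ≤ u 0 ∧ u 0 < a + w ∧ b ≤ u 1 ∧ u 1 < b + h) → ∀ v ∈ p, v ∉ farFrom a b w h n})) →
    (∀ (k : ℕ) (η : ℝ), 0 < η → ∃ N : ℕ, ∀ (S : Set ℤ) (n : ℕ), N ≤ n → ∀ (a b : ℤ) (w h : ℕ),
        w ≤ k * n → h ≤ k * n → ∀ E L : Set Obs, MeasurableSet E → MeasurableSet L →
        RatioMixBound η S n a b w h E L) →
    (∀ bb : Bool, ∃ C lam : ℝ, 0 < lam ∧ ∀ (S : Set ℤ) (n : ℕ), 1 ≤ n → ∀ R : ℕ, n ≤ R → ∀ (a b : ℤ),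
      (νmix S).real {x | ∃ p ∈ monoPaths x bb,
          (∃ u ∈ p, a ≤ u 0 ∧ u 0 < a + n ∧ b ≤ u 1 ∧ u 1 < b + n) ∧ ∃ v ∈ p, v ∈ farFrom a b n n R} ≤
        C * ((n : ℝ) / R) ^ lam) →
    ∃ K₁ : ℂ ≃L[ℝ] ℂ, ∀ ε ρ A : ℝ, 0 < ε → 0 < ρ → 0 < A →
      ∀ᶠ δ in 𝓝[>] (0 : ℝ), ∃ (S₀ S₁ : Set ℤ) (π : Measure (Obs × Obs)),
        (∀ j : ℤ, |j| ≤ (⌈A / δ⌉₊ : ℤ) → j ∈ S₀ ∧ j ∉ S₁) ∧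
        π.map Prod.fst = νmix S₀ ∧ π.map Prod.snd = νmix S₁ ∧
        π (badObs K₁ δ ε ρ) ≤ ENNReal.ofReal ε) →
    Summit.CriticalPhenomena.CardyFormulaZ2.Theses.CardyIKTransport.IKLinearTransport :=
  fun hR4 hGlue hCore =>
    IKLinearTransport_of_farInputs hR4 hGlue fun hK hFar hMix =>
      hCore hK (stub_ExchangeChain hK) (stub_ChainSteps hK) stub_BoxResampler hFar (stub_FarRSWWhite hFar) hMix
        (fun bb => by
          cases bb
          · exact stub_OneArmDecay false (coreInputs_ringFamily_false_of_far hFar)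
          · exact stub_OneArmDecay true (coreInputs_ringFamily_true_of_white (stub_FarRSWWhite hFar)))

end Summit.CriticalPhenomena.CardyFormulaZ2.Theorems.IKLinearTransport.PinnedDiagramExchange

end
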